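import Summits.HodgeConjecture.HodgeConjecture.Theorems.F0P3cCMBorelIwahoriDatumU2Inst   -- ★ p850065 (LH4-p02): `exists_cmIwahoriDatum₂` — its bookkeeping clause `𝓘₂.K n = (K_{|α|^{n+1}} ∩ U′).comap E₂`
import Literature.NumberTheory.Automorphic.ValuedFieldValuativeRelBridge              -- ★ `v_le_iff_valuation_le` (`Valued.v` ↔ `ValuativeRel.valuation`)
import HarnessLib

/-!
# F0 · P3c · line LH6 «StCharTS» — road (D), «HK2-OF-INST★»: every level of the instantiated `U(Φ₂)(L⁺_v)` Iwahori datum is `|α|_w^{n′+1}`-close to `1` in the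
# one-place model — the `hr ∕ hK₂` inputs of ★ p850120 `hfHon_fH0` («HFHON-OF-FH0») at the SAME level `n′` the head picks (no extra depth needed)

Cell `pub/hodgecm-mathlib`, crux H413 = `stmt-HodgeConjecture-24833` (lane `--supports … --as helper`), route HCCMUnconditional; seat A-p16 (g34), «HEAD-DRAFT-A» co-pilot of the
road (D) owner LH6-p04 (g3) (integration note (ii) 2026-09-02T07:36Z, resolved here: the bookkeeping clause of ★ p850065 already pins the level sets, so ★ p850120's `hK₂` holds at
every `n′` with `r := |α|_w^{n′+1} < 1`).  THEOREMS ONLY (no definition, no instance, no notation, no named fact, no `sorry`); ★-only imports.  HONEST LABEL: HC_CM is proved only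
modulo the 7 printed citations (2 remaining: hLiu418 = stmt-HodgeConjecture-24832, h413 = stmt-HodgeConjecture-24833) until rung 0 closes; count-neutral plumbing of road (D).

THE MATHEMATICS.  ★ `exists_cmIwahoriDatum₂` records `𝓘₂.K n = ((congruenceGL 2 (|α|_w^{n+1})).comap U′.subtype).comap E₂` (ValuativeRel valuation); membership in the principal
congruence subgroup bounds the valuations of the entries of `g − 1` (★ `mem_congruenceGL_iff`, the `ValBound` conjunct), and ★ `v_le_iff_valuation_le` converts to `Valued.v`.
[Casselman1995, Prop. 1.4.4; Rogawski1990, §12.7 L. 12.7.3 (proof) p. 195]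

## References
* [Casselman1995] W. Casselman, *Introduction to the theory of admissible representations of 𝔭-adic reductive groups* (1995 notes), §1.4, Prop. 1.4.4 p. 14.
* [Rogawski1990] J. D. Rogawski, *Automorphic Representations of Unitary Groups in Three Variables*, Ann. of Math. Stud. 123 (1990): §4.3 (4.3.1) p. 43; §12.7 Lemma 12.7.3
  (proof) p. 195.
-/

set_option autoImplicit false
-- the mandated namespace has the single-problem summit's repeated segment (`HodgeConjecture.HodgeConjecture`)
set_option linter.dupNamespace false

noncomputable section

open NumberField IsDedekindDomain
open scoped Matrix MatrixGroups WithZero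
open ValuativeRel
open Literature.NumberTheory Literature.NumberTheory.Automorphic Literature.NumberTheory.Automorphic.UnitaryGroup
open Literature.NumberTheory.GaloisRepresentations
open Summit.HodgeConjecture.HodgeConjecture.Cruxes.H413.F0P3cCMLocalNonsplitBorelTransportU2

namespace Summit.HodgeConjecture.HodgeConjecture.Cruxes.H413.F0P3cStCharTSHLevelSmall

variable (L : Type) [Field L] [NumberField L] [IsCMField L] (v : HeightOneSpectrum (𝓞 ↥(maximalRealSubfield L)))
  (w : PlacesOver L v) (hw : IsCMField.complexConj L • w.1 = w.1)

/-- **«HK2-OF-INST★» — the levels of the instantiated H-datum are `|α|_w^{n′+1}`-close to `1`**: from the bookkeeping clause of ★ p850065 `exists_cmIwahoriDatum₂` (text VERBATIM as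
`hK`), for EVERY `n′`, every `k ∈ 𝓘₂.K n′` and all `i j`: `|(E₂ k)ᵢⱼ − δᵢⱼ|_w ≤ |α|_w^{n′+1}` — the `hK₂` hypothesis of ★ p850120 `hfHon_fH0` with `r := Valued.v α ^ (n′ + 1)`
(★ `mem_congruenceGL_iff`, ★ `v_le_iff_valuation_le`). [cite: Casselman1995, Prop. 1.4.4 p. 14] [cite: Rogawski1990, §12.7 L. 12.7.3 (proof) p. 195] -/
theorem forall_level_valued_sub_one_le {α : w.1.adicCompletion L} (𝓘₂ : (cmBorelTriple L 2 v).IwahoriDatum)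
    (hK : ∀ n, 𝓘₂.K n = ((congruenceGL 2 (valuation (w.1.adicCompletion L) α ^ (n + 1))).comap
          (unitaryGroupOfForm (galAdicCompletionMap (L := L) (IsCMField.complexConj L) hw)
            (placeForm (Matrix.of fun i j : Fin 2 => if i.val + j.val + 1 = 2 then (1 : L) else 0) w.1)).subtype).comap
        (localNonsplitEquiv (IsCMField.complexConj L) (Matrix.of fun i j : Fin 2 => if i.val + j.val + 1 = 2 then (1 : L) else 0)
            (IsCMField.complexConj_ne_one L) w hw :
          «local» L (IsCMField.complexConj L) 2 (Matrix.of fun i j : Fin 2 => if i.val + j.val + 1 = 2 then (1 : L) else 0) v →*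
            ↥(unitaryGroupOfForm (galAdicCompletionMap (L := L) (IsCMField.complexConj L) hw)
              (placeForm (Matrix.of fun i j : Fin 2 => if i.val + j.val + 1 = 2 then (1 : L) else 0) w.1))))
    (n' : ℕ) :
    ∀ k ∈ 𝓘₂.K n', ∀ i j, Valued.v ((((localNonsplitEquiv (IsCMField.complexConj L) (Matrix.of fun i j : Fin 2 => if i.val + j.val + 1 = 2 then (1 : L) else 0)
        (IsCMField.complexConj_ne_one L) w hw k :
        ↥(unitaryGroupOfForm (galAdicCompletionMap (L := L) (IsCMField.complexConj L) hw) (placeForm (Matrix.of fun i j : Fin 2 => if i.val + j.val + 1 = 2 then (1 : L) else 0) w.1))) :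
        GL (Fin 2) (w.1.adicCompletion L)) : Matrix (Fin 2) (Fin 2) (w.1.adicCompletion L)) i j - (1 : Matrix (Fin 2) (Fin 2) (w.1.adicCompletion L)) i j) ≤
      Valued.v α ^ (n' + 1) := by
  intro k hk i j
  rw [hK n'] at hk
  have h := ((mem_congruenceGL_iff.1 (Subgroup.mem_comap.1 (Subgroup.mem_comap.1 hk))).2.1 i j)
  rw [Matrix.sub_apply, ← map_pow] at h
  rw [← map_pow]
  exact (v_le_iff_valuation_le _ _).2 h

omit [IsCMField L] in
/-- The radius `|α|_w^{n′+1}` is `< 1` for `|α|_w < 1` — the `hr` input of ★ p850120 `hfHon_fH0`. [cite: Casselman1995, Prop. 1.4.4 p. 14] -/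
theorem valued_pow_succ_lt_one {α : w.1.adicCompletion L} (hα1 : Valued.v α < 1) (n' : ℕ) : Valued.v α ^ (n' + 1) < 1 :=
  pow_lt_one₀ zero_le hα1 (Nat.succ_ne_zero n')

end Summit.HodgeConjecture.HodgeConjecture.Cruxes.H413.F0P3cStCharTSHLevelSmall

end
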